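import Literature.NumberTheory.Weil1964.AdelicDoublingGeometricFrame
import HarnessLib

/-!
# The doubling matrix `δ` on arbitrary vectors of `W ⊕ W⁻`, and the main-orbit Lagrangians `δ((g ⊕ 1) W^Δ)`

Topic `NumberTheory/Weil1964`; namespace `Literature.NumberTheory.Weil1964`.  KERNEL MATHEMATICS ONLY: theorems with
proofs about the tree's definitions `deltaDiagMatrix` / `doublingDelta` (`DoublingDiagonalPolarisation`,
`AdelicDoublingDiagonalLift`); no `def … : Prop`, no `axiom`, no proof hole.

THE PRINTED MATHEMATICS.  In the doubling method ([GelbartPiatetskishapiroRallis1987, Part A §2 pp. 7–9]: "*let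
`V^d = {(v,v) ∈ W}` be the image of the diagonal embedding … let `P` be the parabolic subgroup of `H` preserving
`V^d`*"), Li's rational symplectic matrix `δ` [Li1992, p. 181] carries the diagonal `W^Δ` onto the standard Lagrangian
`𝕐` of the doubled space `𝕎 = W ⊕ W⁻`; the tree records `δ` on DIAGONAL vectors only (`doublingDelta_apply_diag`,
`doublingDelta_symm_apply_zero`).  Unfolding the Siegel Eisenstein series on the doubled group over the orbits of a
subgroup `ι(G') ≤ Sp(𝕎)` on `P_𝕐 \ Sp(𝕎)` ([GelbartPiatetskishapiroRallis1987, Part A §2; Kudla1996, V.3]) requires `δ` on the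
TRANSLATES `g · W^Δ` of the diagonal, i.e. on arbitrary vectors; the closed formula
`δ ((x₁, x₂), (y₁, y₂)) = ((x₁ − x₂, T (y₁ − y₂)), (y₁, T⁻¹ x₂))` is `AdelicDoublingGeometricFrame.doublingDelta_apply_sumElim`
(tree's model `𝕎 = 𝕏 ⊕ 𝕐`, Gram matrix `T ⊕ (−T)`, Darboux frame `darboux`).  §1 here adds its inverse
`δ⁻¹ ((a₁, a₂), (b₁, b₂)) = ((a₁ + T b₂, T b₂), (b₁, b₁ − T⁻¹ a₂))` (`doublingDelta_symm_apply_sumElim`), the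
criterion `(δ v).1 = 0 ↔ v ∈ W^Δ` (`doublingDelta_apply_fst_eq_zero_iff_isDiag`), and the image of a "graph" vector `((x′, x), (y′, y))` — the shape of `(g ⊕ 1)(u, u)`, `u = (x, y)`, `g u = (x′, y′)` —
`δ ((x′, x), (y′, y)) = ((x′ − x, T (y′ − y)), (y′, T⁻¹ x))` (`doublingDelta_apply_graph`).

§2 THE MAIN ORBIT for an `E`-SCALAR `g`.  When `g ∈ Sp(W)` acts as multiplication by a norm-one scalar
`γ = p + q√d ≠ 1` of the quadratic extension `E = F(√d)` on `W = Res_{E/F}(V ⊗_E W₀)` — in the tree's real/imaginary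
polarisation `g (x, y) = (p x + d q y, q x + p y)`, the shape of `toSp (1 ⊗ γ)` [GelbartRogawski1991, §3.1 p. 455] —
the Lagrangian `δ((g ⊕ 1) W^Δ)` is TRANSVERSE to `𝕐` and is the graph `{(a, −𝕋₂⁻¹ σ a)}` of the symmetric matrix
`σ = [[β T, −½], [−½, −d β T⁻¹]]`, `β = q / (2(1 − p))` (we only use the polynomial consequences `2β(1 − p) = q`,
`2dqβ + p + 1 = 0` of `γγ̄ = 1`, and `2h = 1` for the entry `h = ½`): `doublingDelta_spSum_one_apply_diag(_of_scalar)`,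
`doubledGram_inv_mul_sigma_mulVec`, `isSymm_sigma`, `doublingDelta_spSum_one_apply_diag_snd` (every `δ(g ⊕ 1)(u,u)`
is on the graph), `doublingDelta_spSum_one_apply_diag_param` (every graph point is hit), and the packaged
**`doublingDelta_conj_spSum_one_inv_bigCell_conditions`**: the two clauses of the Siegel-parabolic criterion
(`AdelicSiegelBigCellCriterion.ratSp_mul_low_inv_mul_symJ_inv_mem_siegelParabolicPi_iff`) for
`G = δ (g ⊕ 1)⁻¹ δ⁻¹`, i.e. `δ (g ⊕ 1)⁻¹ δ⁻¹ ∈ P_𝕐 · J · n⁻(σ)` — the coset of `(g ⊕ 1)` in `P_𝕐 \ Sp(𝕎)` lies in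
the big cell, so that the corresponding term of the Siegel Eisenstein series `Σ_{P_F\Sp_F} (r_F(γ)Φ)(0)` unfolds to the
orbital integral `∫ Φ(v) ψ(−½ σ[v]) dv` ([GelbartPiatetskishapiroRallis1987, Part A §2 pp. 7–9]: the main orbit of `G × G` on `P \ H`;
[Kudla1996, V.3]).  Statements tagged `[folklore]` are routine linear algebra on the tree's definitions.
-/

set_option autoImplicit false

noncomputable section

open scoped Matrix

namespace Literature.NumberTheory.Weil1964

open Literature.RepresentationTheory.HeisenbergGroup Literature.RepresentationTheory.HeisenbergGroup.SymplecticMatrix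
open Literature.NumberTheory.Automorphic.UnitaryGroup (spSum coe_spSum spSumEquiv_apply)

/-! ## §1 `δ = doublingDelta T` on arbitrary vectors of `W ⊕ W⁻` (sequel of `doublingDelta_apply_sumElim`) -/

section Doubling

variable {K : Type*} [CommRing K] {ι : Type*} [Fintype ι] [DecidableEq ι] (T : Matrix ι ι K) (hT : IsUnit T.det)

/-- `δ` on a vector given by its halves: `δ v = ((v.1|₁ − v.1|₂, T (v.2|₁ − v.2|₂)), (v.2|₁, T⁻¹ v.1|₂))`.
[cite: Li1992, p. 181] -/
theorem doublingDelta_apply (v : ((ι ⊕ ι → K) × (ι ⊕ ι → K))) :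
    ((doublingDelta T hT : (symplecticGroup (polar (Matrix.toLinearMap₂' K (Matrix.fromBlocks T 0 0 (-T)))))) : ((ι ⊕ ι → K) × (ι ⊕ ι → K)) ≃ₗ[K] ((ι ⊕ ι → K) × (ι ⊕ ι → K))) v =
      (Sum.elim (v.1 ∘ Sum.inl - v.1 ∘ Sum.inr) (T *ᵥ (v.2 ∘ Sum.inl - v.2 ∘ Sum.inr)),
        Sum.elim (v.2 ∘ Sum.inl) (T⁻¹ *ᵥ (v.1 ∘ Sum.inr))) := by
  obtain ⟨x, y⟩ := v
  conv_lhs => rw [← Sum.elim_comp_inl_inr x, ← Sum.elim_comp_inl_inr y]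
  exact doublingDelta_apply_sumElim T hT _ _ _ _

/-- **`δ⁻¹` ON AN ARBITRARY VECTOR**: `δ⁻¹ ((a₁, a₂), (b₁, b₂)) = ((a₁ + T b₂, T b₂), (b₁, b₁ − T⁻¹ a₂))`; at
`a₁ = a₂ = 0` this is `doublingDelta_symm_apply_zero`. [cite: Li1992, p. 181] -/
theorem doublingDelta_symm_apply_sumElim (a₁ a₂ b₁ b₂ : ι → K) :
    ((doublingDelta T hT : (symplecticGroup (polar (Matrix.toLinearMap₂' K (Matrix.fromBlocks T 0 0 (-T)))))) : ((ι ⊕ ι → K) × (ι ⊕ ι → K)) ≃ₗ[K] ((ι ⊕ ι → K) × (ι ⊕ ι → K))).symm (Sum.elim a₁ a₂, Sum.elim b₁ b₂) =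
      (Sum.elim (a₁ + T *ᵥ b₂) (T *ᵥ b₂), Sum.elim b₁ (b₁ - T⁻¹ *ᵥ a₂)) := by
  rw [LinearEquiv.symm_apply_eq, doublingDelta_apply_sumElim]
  refine Prod.ext ?_ ?_
  · rw [add_sub_cancel_right, sub_sub_cancel, Matrix.mulVec_mulVec, Matrix.mul_nonsing_inv T hT, Matrix.one_mulVec]
  · rw [Matrix.mulVec_mulVec, Matrix.nonsing_inv_mul T hT, Matrix.one_mulVec]

/-- **`δ` ON A GRAPH VECTOR** `((x′, x), (y′, y))` — the shape of `(g ⊕ 1)(u, u)` for `u = (x, y)`, `g u = (x′, y′)`: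
`δ ((x′, x), (y′, y)) = ((x′ − x, T (y′ − y)), (y′, T⁻¹ x))`.  Its `𝕏`-component is `(g − 1) u` read through
`(1 ⊕ T)`, so `δ((g ⊕ 1) W^Δ)` is transverse to `𝕐` exactly when `g − 1` is invertible (the "main orbit" of the
doubling method). [cite: GelbartPiatetskishapiroRallis1987, Part A §2 pp. 7–9] -/
theorem doublingDelta_apply_graph (x x' y y' : ι → K) :
    ((doublingDelta T hT : (symplecticGroup (polar (Matrix.toLinearMap₂' K (Matrix.fromBlocks T 0 0 (-T)))))) : ((ι ⊕ ι → K) × (ι ⊕ ι → K)) ≃ₗ[K] ((ι ⊕ ι → K) × (ι ⊕ ι → K))) (Sum.elim x' x, Sum.elim y' y) =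
      (Sum.elim (x' - x) (T *ᵥ (y' - y)), Sum.elim y' (T⁻¹ *ᵥ x)) :=
  doublingDelta_apply_sumElim T hT x' x y' y

/-- the `𝕏`-component of `δ v` vanishes iff `v` is diagonal up to `T`: `v.1|₁ = v.1|₂` and `T (v.2|₁ − v.2|₂) = 0`;
when `det T` is a unit this says `v ∈ W^Δ` (`doublingDelta_apply_fst_eq_zero_iff_isDiag`). [cite: Li1992, p. 181] -/
theorem doublingDelta_apply_fst_eq_zero_iff_isDiag (v : ((ι ⊕ ι → K) × (ι ⊕ ι → K))) :
    (((doublingDelta T hT : (symplecticGroup (polar (Matrix.toLinearMap₂' K (Matrix.fromBlocks T 0 0 (-T)))))) : ((ι ⊕ ι → K) × (ι ⊕ ι → K)) ≃ₗ[K] ((ι ⊕ ι → K) × (ι ⊕ ι → K))) v).1 = 0 ↔ IsDiag v := by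
  rw [doublingDelta_apply, IsDiag]
  change Sum.elim (v.1 ∘ Sum.inl - v.1 ∘ Sum.inr) (T *ᵥ (v.2 ∘ Sum.inl - v.2 ∘ Sum.inr)) = 0 ↔ _
  rw [← Sum.elim_zero_zero, Sum.elim_eq_iff, sub_eq_zero, ← gramEquiv_apply T hT,
    (gramEquiv T hT).map_eq_zero_iff, sub_eq_zero]

end Doubling

/-! ## §2 The main-orbit Lagrangians `δ((g ⊕ 1) W^Δ)` for an `E`-scalar `g` -/

section MainOrbit

variable {K : Type*} [CommRing K] {ι : Type*} [Fintype ι] [DecidableEq ι] (T : Matrix ι ι K) (hT : IsUnit T.det)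

include hT in
/-- `(T ⊕ (−T))⁻¹ = T⁻¹ ⊕ (−T⁻¹)`: the inverse Gram matrix of the doubled space `W ⊕ W⁻`. [cite: Kudla1996, V.3] -/
theorem fromBlocks_neg_inv : (Matrix.fromBlocks T 0 0 (-T))⁻¹ = Matrix.fromBlocks T⁻¹ 0 0 (-T⁻¹) := by
  refine Matrix.inv_eq_left_inv ?_
  rw [Matrix.fromBlocks_multiply]
  simp only [Matrix.mul_zero, Matrix.zero_mul, add_zero, zero_add, neg_mul_neg, Matrix.nonsing_inv_mul T hT,
    Matrix.fromBlocks_one]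

omit [Fintype ι] [DecidableEq ι] in
/-- `−(u ⊔ v) = (−u) ⊔ (−v)` for `Sum.elim`. [folklore] -/
private theorem neg_sumElim (u v : ι → K) : -Sum.elim u v = Sum.elim (-u) (-v) := by
  funext i; rcases i with i | i <;> rfl

/-- **`δ (g ⊕ 1)` ON THE DIAGONAL**: for `g ∈ Sp(W)` and `u = (x, y)`, `g u = (x′, y′)`,
`δ ((g ⊕ 1)(u, u)) = ((x′ − x, T (y′ − y)), (y′, T⁻¹ x))` — the translate `(g ⊕ 1) W^Δ` through Li's `δ`.
[cite: GelbartPiatetskishapiroRallis1987, Part A §2 pp. 7–9] -/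
theorem doublingDelta_spSum_one_apply_diag (g : (symplecticGroup (polar (Matrix.toLinearMap₂' K T)))) (x y : ι → K) :
    ((doublingDelta T hT : (symplecticGroup (polar (Matrix.toLinearMap₂' K (Matrix.fromBlocks T 0 0 (-T)))))) : ((ι ⊕ ι → K) × (ι ⊕ ι → K)) ≃ₗ[K] ((ι ⊕ ι → K) × (ι ⊕ ι → K)))
        (((spSum T (-T) (g, 1) : (symplecticGroup (polar (Matrix.toLinearMap₂' K (Matrix.fromBlocks T 0 0 (-T)))))) : ((ι ⊕ ι → K) × (ι ⊕ ι → K)) ≃ₗ[K] ((ι ⊕ ι → K) × (ι ⊕ ι → K))) (Sum.elim x x, Sum.elim y y)) =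
      (Sum.elim (((g : ((ι → K) × (ι → K)) ≃ₗ[K] ((ι → K) × (ι → K))) (x, y)).1 - x) (T *ᵥ (((g : ((ι → K) × (ι → K)) ≃ₗ[K] ((ι → K) × (ι → K))) (x, y)).2 - y)),
        Sum.elim ((g : ((ι → K) × (ι → K)) ≃ₗ[K] ((ι → K) × (ι → K))) (x, y)).2 (T⁻¹ *ᵥ x)) := by
  rw [coe_spSum, spSumEquiv_apply]
  simp only [Sum.elim_comp_inl, Sum.elim_comp_inr, OneMemClass.coe_one, LinearEquiv.coe_one, id_eq]
  exact doublingDelta_apply_graph T hT _ _ _ _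

variable (p q d β h : K) (g : symplecticGroup (polar (Matrix.toLinearMap₂' K T)))

/-- **THE `E`-SCALAR CASE.**  If `g` acts as multiplication by `γ = p + q√d` on `W = Res_{E/F}(…)`, i.e.
`g (x, y) = (p x + d q y, q x + p y)` (the shape of `toSp (1 ⊗ γ)`, [GelbartRogawski1991, §3.1 p. 455]), then
`δ ((g ⊕ 1)(u, u)) = (((p − 1) x + d q y, T (q x + (p − 1) y)), (q x + p y, T⁻¹ x))`. [cite: GelbartPiatetskishapiroRallis1987, Part A §2 pp. 7–9] -/
theorem doublingDelta_spSum_one_apply_diag_of_scalar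
    (hg : ∀ x y : ι → K, (g : ((ι → K) × (ι → K)) ≃ₗ[K] ((ι → K) × (ι → K))) (x, y) = (p • x + (d * q) • y, q • x + p • y)) (x y : ι → K) :
    ((doublingDelta T hT : (symplecticGroup (polar (Matrix.toLinearMap₂' K (Matrix.fromBlocks T 0 0 (-T)))))) : ((ι ⊕ ι → K) × (ι ⊕ ι → K)) ≃ₗ[K] ((ι ⊕ ι → K) × (ι ⊕ ι → K)))
        (((spSum T (-T) (g, 1) : (symplecticGroup (polar (Matrix.toLinearMap₂' K (Matrix.fromBlocks T 0 0 (-T)))))) : ((ι ⊕ ι → K) × (ι ⊕ ι → K)) ≃ₗ[K] ((ι ⊕ ι → K) × (ι ⊕ ι → K))) (Sum.elim x x, Sum.elim y y)) =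
      (Sum.elim ((p - 1) • x + (d * q) • y) (T *ᵥ (q • x + (p - 1) • y)), Sum.elim (q • x + p • y) (T⁻¹ *ᵥ x)) := by
  rw [doublingDelta_spSum_one_apply_diag, hg]
  have e1 : p • x + (d * q) • y - x = (p - 1) • x + (d * q) • y := by rw [sub_smul, one_smul]; abel
  have e2 : q • x + p • y - y = q • x + (p - 1) • y := by rw [sub_smul, one_smul]; abel
  rw [e1, e2]

include hT in
/-- **THE SLOPE**: with `𝕋₂ = T ⊕ (−T)` and the symmetric matrix
`σ = [[β T, −h], [−h, −d β T⁻¹]]` (`2h = 1`), `(𝕋₂⁻¹ σ)(a₁, a₂) = (β a₁ − h T⁻¹ a₂, h T⁻¹ a₁ + d β T⁻² a₂)` —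
the slope of the main-orbit Lagrangian. [cite: GelbartPiatetskishapiroRallis1987, Part A §2 pp. 7–9] -/
theorem doubledGram_inv_mul_sigma_mulVec (a₁ a₂ : ι → K) :
    ((Matrix.fromBlocks T 0 0 (-T))⁻¹ *
          Matrix.fromBlocks (β • T) (-(h • (1 : Matrix ι ι K))) (-(h • (1 : Matrix ι ι K))) (-((d * β) • T⁻¹))) *ᵥ
        Sum.elim a₁ a₂ =
      Sum.elim (β • a₁ - h • T⁻¹ *ᵥ a₂) (h • T⁻¹ *ᵥ a₁ + (d * β) • T⁻¹ *ᵥ (T⁻¹ *ᵥ a₂)) := by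
  rw [fromBlocks_neg_inv T hT, Matrix.fromBlocks_multiply, Matrix.fromBlocks_mulVec]
  simp only [Sum.elim_comp_inl, Sum.elim_comp_inr, Matrix.zero_mul, Matrix.mul_smul, Matrix.mul_one, Matrix.neg_mul,
    Matrix.mul_neg, Matrix.nonsing_inv_mul T hT, smul_zero, neg_zero, add_zero, zero_add, smul_neg, neg_neg]
  rw [Matrix.smul_mulVec, Matrix.one_mulVec, Matrix.neg_mulVec, Matrix.smul_mulVec, Matrix.smul_mulVec,
    Matrix.smul_mulVec, ← Matrix.mulVec_mulVec, sub_eq_add_neg]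

/-- `σ = [[β T, −h], [−h, −d β T⁻¹]]` is symmetric when `T` is (the main-orbit Lagrangian is Lagrangian).
[cite: GelbartPiatetskishapiroRallis1987, Part A §2 pp. 7–9] -/
theorem isSymm_sigma (hTs : T.IsSymm) :
    (Matrix.fromBlocks (β • T) (-(h • (1 : Matrix ι ι K))) (-(h • (1 : Matrix ι ι K))) (-((d * β) • T⁻¹))).IsSymm := by
  refine Matrix.IsSymm.fromBlocks (hTs.smul β) ?_ ((hTs.inv).smul (d * β)).neg
  rw [Matrix.transpose_neg, Matrix.transpose_smul, Matrix.transpose_one]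

variable (h1 : 2 * β * (1 - p) = q) (h2 : 2 * d * q * β + p + 1 = 0) (hh : 2 * h = 1)
  (hg : ∀ x y : ι → K, (g : ((ι → K) × (ι → K)) ≃ₗ[K] ((ι → K) × (ι → K))) (x, y) = (p • x + (d * q) • y, q • x + p • y))
include h1 h2 hh hg

/-- **THE LAGRANGIAN `δ((g ⊕ 1) W^Δ)` IS THE GRAPH OF `−𝕋₂⁻¹σ`** (`E`-scalar `g = γ = p + q√d` with `γ γ̄ = 1`,
`γ ≠ 1`, `β = q / (2(1 − p))`, so `2β(1 − p) = q` and `2dqβ + p + 1 = 0`): for every diagonal vector `(u, u)`,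
`δ((g ⊕ 1)(u, u)) = (a, −(𝕋₂⁻¹σ) a)`. [cite: GelbartPiatetskishapiroRallis1987, Part A §2 pp. 7–9] -/
theorem doublingDelta_spSum_one_apply_diag_snd (x y : ι → K) :
    (((doublingDelta T hT : (symplecticGroup (polar (Matrix.toLinearMap₂' K (Matrix.fromBlocks T 0 0 (-T)))))) : ((ι ⊕ ι → K) × (ι ⊕ ι → K)) ≃ₗ[K] ((ι ⊕ ι → K) × (ι ⊕ ι → K)))
          (((spSum T (-T) (g, 1) : (symplecticGroup (polar (Matrix.toLinearMap₂' K (Matrix.fromBlocks T 0 0 (-T)))))) : ((ι ⊕ ι → K) × (ι ⊕ ι → K)) ≃ₗ[K] ((ι ⊕ ι → K) × (ι ⊕ ι → K))) (Sum.elim x x, Sum.elim y y))).2 =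
      -(((Matrix.fromBlocks T 0 0 (-T))⁻¹ *
            Matrix.fromBlocks (β • T) (-(h • (1 : Matrix ι ι K))) (-(h • (1 : Matrix ι ι K))) (-((d * β) • T⁻¹))) *ᵥ
          (((doublingDelta T hT : (symplecticGroup (polar (Matrix.toLinearMap₂' K (Matrix.fromBlocks T 0 0 (-T)))))) : ((ι ⊕ ι → K) × (ι ⊕ ι → K)) ≃ₗ[K] ((ι ⊕ ι → K) × (ι ⊕ ι → K)))
            (((spSum T (-T) (g, 1) : (symplecticGroup (polar (Matrix.toLinearMap₂' K (Matrix.fromBlocks T 0 0 (-T)))))) : ((ι ⊕ ι → K) × (ι ⊕ ι → K)) ≃ₗ[K] ((ι ⊕ ι → K) × (ι ⊕ ι → K))) (Sum.elim x x, Sum.elim y y))).1) := by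
  rw [doublingDelta_spSum_one_apply_diag_of_scalar T hT p q d g hg]
  dsimp only
  rw [doubledGram_inv_mul_sigma_mulVec T hT, Matrix.mulVec_mulVec, Matrix.nonsing_inv_mul T hT, Matrix.one_mulVec,
    neg_sumElim]
  have v1 : q • x + p • y = -(β • ((p - 1) • x + (d * q) • y) - h • (q • x + (p - 1) • y)) := by
    funext i
    simp only [Pi.add_apply, Pi.sub_apply, Pi.neg_apply, Pi.smul_apply, smul_eq_mul]
    linear_combination (-(h * x i)) * h1 + (-((q + β * p - β) * x i)) * hh + (h * y i) * h2 +
      (-((p + d * q * β) * y i)) * hh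
  have v2 : T⁻¹ *ᵥ x = -(h • T⁻¹ *ᵥ ((p - 1) • x + (d * q) • y) + (d * β) • T⁻¹ *ᵥ (q • x + (p - 1) • y)) := by
    rw [← Matrix.mulVec_smul, ← Matrix.mulVec_smul, ← Matrix.mulVec_add, ← Matrix.mulVec_neg]
    congr 1
    funext i
    simp only [Pi.add_apply, Pi.neg_apply, Pi.smul_apply, smul_eq_mul]
    linear_combination (h * x i) * h2 + (-((1 + d * q * β) * x i)) * hh + (-(h * d * y i)) * h1 +
      (-(d * β * (p - 1) * y i)) * hh
  rw [← v1, ← v2]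

/-- **… AND EVERY GRAPH VECTOR IS HIT**: for `a = (a₁, a₂)` put `u = (−h a₁ − dβ T⁻¹ a₂, −β a₁ − h T⁻¹ a₂)`; then
`δ((g ⊕ 1)(u, u)) = (a, −(𝕋₂⁻¹σ) a)` — `δ((g ⊕ 1) W^Δ)` is exactly the graph (transverse to `𝕐`: the main orbit).
[cite: GelbartPiatetskishapiroRallis1987, Part A §2 pp. 7–9] -/
theorem doublingDelta_spSum_one_apply_diag_param (a₁ a₂ : ι → K) :
    ((doublingDelta T hT : (symplecticGroup (polar (Matrix.toLinearMap₂' K (Matrix.fromBlocks T 0 0 (-T)))))) : ((ι ⊕ ι → K) × (ι ⊕ ι → K)) ≃ₗ[K] ((ι ⊕ ι → K) × (ι ⊕ ι → K)))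
        (((spSum T (-T) (g, 1) : (symplecticGroup (polar (Matrix.toLinearMap₂' K (Matrix.fromBlocks T 0 0 (-T)))))) : ((ι ⊕ ι → K) × (ι ⊕ ι → K)) ≃ₗ[K] ((ι ⊕ ι → K) × (ι ⊕ ι → K)))
          (Sum.elim (-(h • a₁) - (d * β) • T⁻¹ *ᵥ a₂) (-(h • a₁) - (d * β) • T⁻¹ *ᵥ a₂),
            Sum.elim (-(β • a₁) - h • T⁻¹ *ᵥ a₂) (-(β • a₁) - h • T⁻¹ *ᵥ a₂))) =
      (Sum.elim a₁ a₂,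
        -(((Matrix.fromBlocks T 0 0 (-T))⁻¹ *
            Matrix.fromBlocks (β • T) (-(h • (1 : Matrix ι ι K))) (-(h • (1 : Matrix ι ι K))) (-((d * β) • T⁻¹))) *ᵥ
          Sum.elim a₁ a₂)) := by
  have hfst : (((doublingDelta T hT : (symplecticGroup (polar (Matrix.toLinearMap₂' K (Matrix.fromBlocks T 0 0 (-T)))))) : ((ι ⊕ ι → K) × (ι ⊕ ι → K)) ≃ₗ[K] ((ι ⊕ ι → K) × (ι ⊕ ι → K)))
        (((spSum T (-T) (g, 1) : (symplecticGroup (polar (Matrix.toLinearMap₂' K (Matrix.fromBlocks T 0 0 (-T)))))) : ((ι ⊕ ι → K) × (ι ⊕ ι → K)) ≃ₗ[K] ((ι ⊕ ι → K) × (ι ⊕ ι → K)))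
          (Sum.elim (-(h • a₁) - (d * β) • T⁻¹ *ᵥ a₂) (-(h • a₁) - (d * β) • T⁻¹ *ᵥ a₂),
            Sum.elim (-(β • a₁) - h • T⁻¹ *ᵥ a₂) (-(β • a₁) - h • T⁻¹ *ᵥ a₂)))).1 = Sum.elim a₁ a₂ := by
    rw [doublingDelta_spSum_one_apply_diag_of_scalar T hT p q d g hg]
    dsimp only
    have w1 : (p - 1) • (-(h • a₁) - (d * β) • T⁻¹ *ᵥ a₂) + (d * q) • (-(β • a₁) - h • T⁻¹ *ᵥ a₂) = a₁ := by
      have : (p - 1) • (-(h • a₁) - (d * β) • T⁻¹ *ᵥ a₂) + (d * q) • (-(β • a₁) - h • T⁻¹ *ᵥ a₂) =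
          (-((p - 1) * h) - d * q * β) • a₁ + (-((p - 1) * (d * β)) - d * q * h) • T⁻¹ *ᵥ a₂ := by
        simp only [smul_sub, smul_neg, smul_smul, sub_smul, neg_smul]
        abel
      rw [this]
      have c1 : -((p - 1) * h) - d * q * β = 1 := by
        linear_combination (-h) * h2 + (1 + d * q * β) * hh
      have c2 : -((p - 1) * (d * β)) - d * q * h = 0 := by
        linear_combination (h * d) * h1 + (d * β * (p - 1)) * hh
      rw [c1, c2, one_smul, zero_smul, add_zero]
    have w2 : T *ᵥ (q • (-(h • a₁) - (d * β) • T⁻¹ *ᵥ a₂) + (p - 1) • (-(β • a₁) - h • T⁻¹ *ᵥ a₂)) = a₂ := by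
      have : q • (-(h • a₁) - (d * β) • T⁻¹ *ᵥ a₂) + (p - 1) • (-(β • a₁) - h • T⁻¹ *ᵥ a₂) =
          (-(q * h) - (p - 1) * β) • a₁ + (-(q * (d * β)) - (p - 1) * h) • T⁻¹ *ᵥ a₂ := by
        simp only [smul_sub, smul_neg, smul_smul, sub_smul, neg_smul]
        abel
      rw [this]
      have c1 : -(q * h) - (p - 1) * β = 0 := by
        linear_combination h * h1 + (β * p - β) * hh
      have c2 : -(q * (d * β)) - (p - 1) * h = 1 := by
        linear_combination (-h) * h2 + (1 + d * q * β) * hh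
      rw [c1, c2, zero_smul, one_smul, zero_add, Matrix.mulVec_mulVec, Matrix.mul_nonsing_inv T hT,
        Matrix.one_mulVec]
    rw [w1, w2]
  refine Prod.ext hfst ?_
  rw [doublingDelta_spSum_one_apply_diag_snd T hT p q d β h g h1 h2 hh hg, hfst]

/-- **BIG-CELL CONDITIONS FOR THE COSET OF `(g ⊕ 1)⁻¹`** — the two clauses of the Siegel-parabolic membership
criterion for `G = δ (g ⊕ 1)⁻¹ δ⁻¹` with slope `𝕋₂⁻¹σ`: (i) `G (a, −(𝕋₂⁻¹σ) a) ∈ 𝕐` for all `a`;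
(ii) `G⁻¹ 𝕐` lies on the graph `{(a, −(𝕋₂⁻¹σ) a)}`.  With the criterion of `AdelicSiegelBigCellCriterion` this puts
`δ (g ⊕ 1)⁻¹ δ⁻¹` in the big cell `P_𝕐 · J · n⁻(σ)`: the `γ`-th term of the unfolded Siegel Eisenstein series is the
Siegel–Weil orbital integral at `σ_γ`. [cite: GelbartPiatetskishapiroRallis1987, Part A §2 pp. 7–9] -/
theorem doublingDelta_conj_spSum_one_inv_bigCell_conditions :
    (∀ a : ι ⊕ ι → K,
        (((doublingDelta T hT * (spSum T (-T) (g, 1))⁻¹ * (doublingDelta T hT)⁻¹ : (symplecticGroup (polar (Matrix.toLinearMap₂' K (Matrix.fromBlocks T 0 0 (-T)))))) : ((ι ⊕ ι → K) × (ι ⊕ ι → K)) ≃ₗ[K] ((ι ⊕ ι → K) × (ι ⊕ ι → K)))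
            (a, -(((Matrix.fromBlocks T 0 0 (-T))⁻¹ *
                Matrix.fromBlocks (β • T) (-(h • (1 : Matrix ι ι K))) (-(h • (1 : Matrix ι ι K)))
                  (-((d * β) • T⁻¹))) *ᵥ a))).1 = 0) ∧
      ∀ y : ι ⊕ ι → K,
        (((doublingDelta T hT * (spSum T (-T) (g, 1))⁻¹ * (doublingDelta T hT)⁻¹ : (symplecticGroup (polar (Matrix.toLinearMap₂' K (Matrix.fromBlocks T 0 0 (-T)))))) : ((ι ⊕ ι → K) × (ι ⊕ ι → K)) ≃ₗ[K] ((ι ⊕ ι → K) × (ι ⊕ ι → K))).symm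
            (0, y)).2 =
          -(((Matrix.fromBlocks T 0 0 (-T))⁻¹ *
                Matrix.fromBlocks (β • T) (-(h • (1 : Matrix ι ι K))) (-(h • (1 : Matrix ι ι K)))
                  (-((d * β) • T⁻¹))) *ᵥ
            ((((doublingDelta T hT * (spSum T (-T) (g, 1))⁻¹ * (doublingDelta T hT)⁻¹ : (symplecticGroup (polar (Matrix.toLinearMap₂' K (Matrix.fromBlocks T 0 0 (-T)))))) :
                ((ι ⊕ ι → K) × (ι ⊕ ι → K)) ≃ₗ[K] ((ι ⊕ ι → K) × (ι ⊕ ι → K))).symm (0, y)).1)) := by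
  have hG : ∀ v : ((ι ⊕ ι → K) × (ι ⊕ ι → K)),
      ((doublingDelta T hT * (spSum T (-T) (g, 1))⁻¹ * (doublingDelta T hT)⁻¹ : (symplecticGroup (polar (Matrix.toLinearMap₂' K (Matrix.fromBlocks T 0 0 (-T)))))) : ((ι ⊕ ι → K) × (ι ⊕ ι → K)) ≃ₗ[K] ((ι ⊕ ι → K) × (ι ⊕ ι → K))) v =
        ((doublingDelta T hT : (symplecticGroup (polar (Matrix.toLinearMap₂' K (Matrix.fromBlocks T 0 0 (-T)))))) : ((ι ⊕ ι → K) × (ι ⊕ ι → K)) ≃ₗ[K] ((ι ⊕ ι → K) × (ι ⊕ ι → K)))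
          ((((spSum T (-T) (g, 1) : (symplecticGroup (polar (Matrix.toLinearMap₂' K (Matrix.fromBlocks T 0 0 (-T)))))) : ((ι ⊕ ι → K) × (ι ⊕ ι → K)) ≃ₗ[K] ((ι ⊕ ι → K) × (ι ⊕ ι → K)))).symm
            ((((doublingDelta T hT : (symplecticGroup (polar (Matrix.toLinearMap₂' K (Matrix.fromBlocks T 0 0 (-T)))))) : ((ι ⊕ ι → K) × (ι ⊕ ι → K)) ≃ₗ[K] ((ι ⊕ ι → K) × (ι ⊕ ι → K)))).symm v)) := fun v => rfl
  have hGs : ∀ v : ((ι ⊕ ι → K) × (ι ⊕ ι → K)),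
      ((doublingDelta T hT * (spSum T (-T) (g, 1))⁻¹ * (doublingDelta T hT)⁻¹ : (symplecticGroup (polar (Matrix.toLinearMap₂' K (Matrix.fromBlocks T 0 0 (-T)))))) : ((ι ⊕ ι → K) × (ι ⊕ ι → K)) ≃ₗ[K] ((ι ⊕ ι → K) × (ι ⊕ ι → K))).symm v =
        ((doublingDelta T hT : (symplecticGroup (polar (Matrix.toLinearMap₂' K (Matrix.fromBlocks T 0 0 (-T)))))) : ((ι ⊕ ι → K) × (ι ⊕ ι → K)) ≃ₗ[K] ((ι ⊕ ι → K) × (ι ⊕ ι → K)))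
          (((spSum T (-T) (g, 1) : (symplecticGroup (polar (Matrix.toLinearMap₂' K (Matrix.fromBlocks T 0 0 (-T)))))) : ((ι ⊕ ι → K) × (ι ⊕ ι → K)) ≃ₗ[K] ((ι ⊕ ι → K) × (ι ⊕ ι → K)))
            ((((doublingDelta T hT : (symplecticGroup (polar (Matrix.toLinearMap₂' K (Matrix.fromBlocks T 0 0 (-T)))))) : ((ι ⊕ ι → K) × (ι ⊕ ι → K)) ≃ₗ[K] ((ι ⊕ ι → K) × (ι ⊕ ι → K)))).symm v)) := fun v => rfl
  refine ⟨fun a => ?_, fun y => ?_⟩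
  · rw [hG, ← Sum.elim_comp_inl_inr a,
      ← doublingDelta_spSum_one_apply_diag_param T hT p q d β h g h1 h2 hh hg (a ∘ Sum.inl) (a ∘ Sum.inr),
      LinearEquiv.symm_apply_apply, LinearEquiv.symm_apply_apply, doublingDelta_apply_diag]
  · rw [hGs, doublingDelta_symm_apply_zero]
    exact doublingDelta_spSum_one_apply_diag_snd T hT p q d β h g h1 h2 hh hg _ _

end MainOrbit

end Literature.NumberTheory.Weil1964

end
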